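import Mathlib.Analysis.Calculus.ContDiff.Bounds
import Mathlib.Analysis.Calculus.ContDiff.Deriv
import Mathlib.Analysis.Calculus.IteratedDeriv.Lemmas
import Mathlib.Analysis.Calculus.Deriv.Comp
import HarnessLib

/-!
# Benfatto–Giuliani–Mastropietro 2006, §2.5, proof of Lemma 2.2 (2.55): the two-scale Leibniz /
Faà di Bruno bookkeeping behind "`∂^N_{k'₂}[F_{h,ω}/D_{h-1}] = O(γ^{-Nh})` for `N ≥ 2`"

Companion proof file of `BGM2006Sec2Setup.lean` (typer-wave file F1a of the cell `gate-hubbard-kl`; source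
BGM06 = G. Benfatto, A. Giuliani, V. Mastropietro, *Fermi liquid behavior in the 2D Hubbard model at low
temperatures*, Ann. Henri Poincaré **7** (2006) 809–898, arXiv:cond-mat/0507686; locators `p00NN:Lnn` =
chunk/line of the `lit read` render of the arXiv TeX).

BGM, p0011:L17–L22: "Using (2.53), (2.42) and the fact that the `n`-th order derivative of `ζ_{h,ω}(θ)` is of
order `γ^{-nh/2}`, it is easy to see that `∂^N_{k'₂}[F_{h,ω}/(-ik₀ + E_{h-1} - μ)] = O(γ^{-Nh})` for `N ≥ 2`."
The mechanism is a TWO-SCALE derivative profile along the tangential line: every factor `f` of the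
integrand satisfies, at the point,
`‖f^{(i)}‖ ≤ A σ^{min(i,2)} ρⁱ` (`i ≤ n`), `σ = γ^{h/2} ≤ 1`, `ρ = γ^{-h}`
(one tangential derivative costs only `γ^{-h/2}` by (2.53) and the sector width, two or more cost `γ^{-h}`
each but with one overall factor `γ^h` spared by (2.42)), and this profile is stable under sums, products
and composition with functions of bounded derivatives — whence the quotient is `γ^{-h}`·(profile) and
`N ≥ 2` derivatives cost `γ^{-h}σ²ρᴺ = γ^{-Nh}`.  This file PROVES the stability statements as pointwise
inequalities for `iteratedDeriv` at a point `x` of an open set on which the factors are `Cⁿ` (the factors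
of (2.55) — the angle, `1/D_{h-1}` — are smooth only locally), constants depending on `n` and the profile
constants only:

* `norm_iteratedDeriv_le_twoScale_of_oneScale` — a one-scale profile `A(σρ)ⁱ` (the angular factor:
  `γ^{-h/2} = σρ`) is a two-scale profile;
* `norm_iteratedDeriv_add_le_twoScale`, `norm_iteratedDeriv_sub_le_twoScale`,
  `norm_iteratedDeriv_const_smul_le_twoScale` — linearity;
* `norm_iteratedDeriv_bilinear_le_twoScale` — continuous bilinear maps (Leibniz): constants `‖B‖2ⁿAA'`;
  `norm_iteratedDeriv_mul_le_twoScale`, `norm_iteratedDeriv_smul_le_twoScale` — products and scalar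
  products: `2ⁿAA'`;
* `norm_iteratedDeriv_comp_le_twoScale` — composition `g ∘ f` with `f` real of two-scale profile (orders
  `≥ 1`) and `g` with `‖g^{(m)}(f(x))‖ ≤ G` (`m ≤ n`), both `Cⁿ` on open sets (Faà di Bruno by induction on
  the order through `(g ∘ f)' = f'·(g' ∘ f)`): constants `G(2ⁿ(1 + A))ᵏ`.

Everything is proved; no definitions, no named facts, no `sorry`, no instances, no notation.

## Sources

* [BGM06] G. Benfatto, A. Giuliani, V. Mastropietro, Ann. Henri Poincaré 7 (2006) 809–898,
  arXiv:cond-mat/0507686, §2.5 proof of Lemma 2.2 (2.53)–(2.55) p0010:L129–p0011:L22.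
  [BenfattoGiulianiMastropietro2006]
-/

noncomputable section

open Finset Set

namespace Literature.MathematicalPhysics.QuantumLattice.FermiRG

/-! ### The two-scale exponent bookkeeping -/

/-- `σ^{min(i,2)} σ^{min(j,2)} ≤ σ^{min(i+j,2)}` for `0 ≤ σ ≤ 1`. [folklore] -/
private theorem pow_min_two_mul_le {σ : ℝ} (hσ0 : 0 ≤ σ) (hσ1 : σ ≤ 1) (i j : ℕ) :
    σ ^ min i 2 * σ ^ min j 2 ≤ σ ^ min (i + j) 2 := by
  rw [← pow_add]
  exact pow_le_pow_of_le_one hσ0 hσ1 (by omega)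

/-- On an open set the `Within` iterated derivative is the plain one (norm form, one variable). [folklore] -/
private theorem norm_iteratedFDerivWithin_eq_of_isOpen {V : Type*} [NormedAddCommGroup V] [NormedSpace ℝ V]
    {s : Set ℝ} (hs : IsOpen s) {x : ℝ} (hx : x ∈ s) (φ : ℝ → V) (i : ℕ) :
    ‖iteratedFDerivWithin ℝ i φ s x‖ = ‖iteratedDeriv i φ x‖ := by
  rw [iteratedFDerivWithin_of_isOpen i hs hx, norm_iteratedFDeriv_eq_norm_iteratedDeriv]

/-- The Leibniz sum under two two-scale profiles: `Σ C(n,i) aᵢ b_{n-i} ≤ 2ⁿ A B σ^{min(n,2)} ρⁿ`. [folklore] -/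
private theorem sum_choose_mul_le_twoScale {n : ℕ} {a b : ℕ → ℝ} {A B σ ρ : ℝ} (hσ0 : 0 ≤ σ) (hσ1 : σ ≤ 1)
    (hρ : 0 ≤ ρ) (hb0 : ∀ i ≤ n, 0 ≤ b i)
    (ha : ∀ i ≤ n, a i ≤ A * σ ^ min i 2 * ρ ^ i) (hb : ∀ i ≤ n, b i ≤ B * σ ^ min i 2 * ρ ^ i)
    (hA0 : 0 ≤ A) (hB0 : 0 ≤ B) :
    ∑ i ∈ range (n + 1), (n.choose i : ℝ) * a i * b (n - i) ≤ 2 ^ n * A * B * σ ^ min n 2 * ρ ^ n := by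
  calc ∑ i ∈ range (n + 1), (n.choose i : ℝ) * a i * b (n - i)
      ≤ ∑ i ∈ range (n + 1), (n.choose i : ℝ) * (A * B * σ ^ min n 2 * ρ ^ n) := by
        refine sum_le_sum fun i hi => ?_
        have hin : i ≤ n := Nat.lt_succ_iff.1 (mem_range.1 hi)
        rw [mul_assoc]
        refine mul_le_mul_of_nonneg_left ?_ (Nat.cast_nonneg _)
        calc a i * b (n - i)
            ≤ (A * σ ^ min i 2 * ρ ^ i) * (B * σ ^ min (n - i) 2 * ρ ^ (n - i)) :=
              mul_le_mul (ha i hin) (hb (n - i) (Nat.sub_le n i)) (hb0 _ (Nat.sub_le n i)) (by positivity)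
          _ = A * B * (σ ^ min i 2 * σ ^ min (n - i) 2) * (ρ ^ i * ρ ^ (n - i)) := by ring
          _ ≤ A * B * σ ^ min n 2 * (ρ ^ i * ρ ^ (n - i)) := by
              have h := pow_min_two_mul_le hσ0 hσ1 i (n - i)
              rw [Nat.add_sub_cancel' hin] at h
              have : 0 ≤ ρ ^ i * ρ ^ (n - i) := by positivity
              exact mul_le_mul_of_nonneg_right (mul_le_mul_of_nonneg_left h (mul_nonneg hA0 hB0)) this
          _ = A * B * σ ^ min n 2 * ρ ^ n := by rw [← pow_add, Nat.add_sub_cancel' hin]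
    _ = 2 ^ n * A * B * σ ^ min n 2 * ρ ^ n := by
        rw [← sum_mul]
        have h : ∑ i ∈ range (n + 1), (n.choose i : ℝ) = 2 ^ n := by exact_mod_cast Nat.sum_range_choose n
        rw [h]; ring

/-- The order-zero instance of a profile bound gives `0 ≤ A`. [folklore] -/
private theorem nonneg_of_profile {V : Type*} [NormedAddCommGroup V] [NormedSpace ℝ V] {φ : ℝ → V} {x : ℝ} {n : ℕ} {A σ ρ : ℝ}
    (hA : ∀ i ≤ n, ‖iteratedDeriv i φ x‖ ≤ A * σ ^ min i 2 * ρ ^ i) : 0 ≤ A := by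
  have h := hA 0 (Nat.zero_le n)
  simp only [pow_zero, mul_one, Nat.zero_min] at h
  exact (norm_nonneg _).trans h

/-! ### One scale is two scales; linearity -/

section Linear

variable {V : Type*} [NormedAddCommGroup V] [NormedSpace ℝ V]

/-- **A one-scale profile is a two-scale profile**: `‖φ^{(i)}(x)‖ ≤ A(σρ)ⁱ` (`i ≤ n`, `0 ≤ σ ≤ 1`, `ρ ≥ 0`)
implies `‖φ^{(i)}(x)‖ ≤ Aσ^{min(i,2)}ρⁱ` — the angular factor `ζ_{h,ω}(θ)`, whose `i`-th tangential derivative is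
of order `γ^{-ih/2} = (σρ)ⁱ`. [cite: BenfattoGiulianiMastropietro2006, §2.5 proof of Lemma 2.2 (2.55) p0011:L17–L22] -/
theorem norm_iteratedDeriv_le_twoScale_of_oneScale {φ : ℝ → V} {x : ℝ} {n : ℕ} {A σ ρ : ℝ} (hσ0 : 0 ≤ σ)
    (hσ1 : σ ≤ 1) (hρ : 0 ≤ ρ) (hA0 : 0 ≤ A) (hA : ∀ i ≤ n, ‖iteratedDeriv i φ x‖ ≤ A * (σ * ρ) ^ i) :
    ∀ i ≤ n, ‖iteratedDeriv i φ x‖ ≤ A * σ ^ min i 2 * ρ ^ i := by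
  intro i hi
  refine (hA i hi).trans ?_
  rw [mul_pow, mul_assoc]
  refine mul_le_mul_of_nonneg_left (mul_le_mul_of_nonneg_right ?_ (pow_nonneg hρ _)) hA0
  exact pow_le_pow_of_le_one hσ0 hσ1 (min_le_left i 2)

/-- **Sums keep the profile** (constants add). [cite: BenfattoGiulianiMastropietro2006, §2.5 proof of Lemma 2.2 (2.55) p0011:L17–L22] -/
theorem norm_iteratedDeriv_add_le_twoScale {f g : ℝ → V} {x : ℝ} {n : ℕ} (hf : ContDiffAt ℝ n f x)
    (hg : ContDiffAt ℝ n g x) {A B σ ρ : ℝ}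
    (hA : ∀ i ≤ n, ‖iteratedDeriv i f x‖ ≤ A * σ ^ min i 2 * ρ ^ i)
    (hB : ∀ i ≤ n, ‖iteratedDeriv i g x‖ ≤ B * σ ^ min i 2 * ρ ^ i) :
    ∀ i ≤ n, ‖iteratedDeriv i (fun y => f y + g y) x‖ ≤ (A + B) * σ ^ min i 2 * ρ ^ i := by
  intro i hi
  have hfi : ContDiffAt ℝ i f x := hf.of_le (by exact_mod_cast hi)
  have hgi : ContDiffAt ℝ i g x := hg.of_le (by exact_mod_cast hi)
  have e : iteratedDeriv i (fun y => f y + g y) x = iteratedDeriv i f x + iteratedDeriv i g x := by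
    have h := iteratedFDeriv_add_apply hfi hgi
    simp only [iteratedDeriv_eq_iteratedFDeriv]
    rw [show (fun y => f y + g y) = f + g from rfl, h]; rfl
  rw [e]
  calc ‖iteratedDeriv i f x + iteratedDeriv i g x‖ ≤ ‖iteratedDeriv i f x‖ + ‖iteratedDeriv i g x‖ := norm_add_le _ _
    _ ≤ A * σ ^ min i 2 * ρ ^ i + B * σ ^ min i 2 * ρ ^ i := add_le_add (hA i hi) (hB i hi)
    _ = (A + B) * σ ^ min i 2 * ρ ^ i := by ring

/-- **Differences keep the profile** (constants add). [cite: BenfattoGiulianiMastropietro2006, §2.5 proof of Lemma 2.2 (2.55) p0011:L17–L22] -/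
theorem norm_iteratedDeriv_sub_le_twoScale {f g : ℝ → V} {x : ℝ} {n : ℕ} (hf : ContDiffAt ℝ n f x)
    (hg : ContDiffAt ℝ n g x) {A B σ ρ : ℝ}
    (hA : ∀ i ≤ n, ‖iteratedDeriv i f x‖ ≤ A * σ ^ min i 2 * ρ ^ i)
    (hB : ∀ i ≤ n, ‖iteratedDeriv i g x‖ ≤ B * σ ^ min i 2 * ρ ^ i) :
    ∀ i ≤ n, ‖iteratedDeriv i (fun y => f y - g y) x‖ ≤ (A + B) * σ ^ min i 2 * ρ ^ i := by
  intro i hi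
  have hfi : ContDiffAt ℝ i f x := hf.of_le (by exact_mod_cast hi)
  have hgi : ContDiffAt ℝ i g x := hg.of_le (by exact_mod_cast hi)
  have e : iteratedDeriv i (fun y => f y - g y) x = iteratedDeriv i f x - iteratedDeriv i g x := by
    have h := iteratedFDeriv_sub_apply hfi hgi
    simp only [iteratedDeriv_eq_iteratedFDeriv]
    rw [show (fun y => f y - g y) = f - g from rfl, h]; rfl
  rw [e]
  calc ‖iteratedDeriv i f x - iteratedDeriv i g x‖ ≤ ‖iteratedDeriv i f x‖ + ‖iteratedDeriv i g x‖ := norm_sub_le _ _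
    _ ≤ A * σ ^ min i 2 * ρ ^ i + B * σ ^ min i 2 * ρ ^ i := add_le_add (hA i hi) (hB i hi)
    _ = (A + B) * σ ^ min i 2 * ρ ^ i := by ring

/-- **Constant multiples keep the profile** (`‖c‖A`; the overall `γ^{-h}` of `1/D_{h-1}` is extracted this way).
[cite: BenfattoGiulianiMastropietro2006, §2.5 proof of Lemma 2.2 (2.55) p0011:L17–L22] -/
theorem norm_iteratedDeriv_const_smul_le_twoScale {f : ℝ → V} {x : ℝ} {n : ℕ} (hf : ContDiffAt ℝ n f x) (c : ℝ)
    {A σ ρ : ℝ} (hA : ∀ i ≤ n, ‖iteratedDeriv i f x‖ ≤ A * σ ^ min i 2 * ρ ^ i) :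
    ∀ i ≤ n, ‖iteratedDeriv i (fun y => c • f y) x‖ ≤ ‖c‖ * A * σ ^ min i 2 * ρ ^ i := by
  intro i hi
  have hfi : ContDiffAt ℝ i f x := hf.of_le (by exact_mod_cast hi)
  rw [show (fun y => c • f y) = c • f from rfl, iteratedDeriv_const_smul hfi c, norm_smul, mul_assoc, mul_assoc]
  exact mul_le_mul_of_nonneg_left (by rw [← mul_assoc]; exact hA i hi) (norm_nonneg _)

end Linear

/-! ### Products through a continuous bilinear map -/

section Bilinear

variable {E₁ E₂ G : Type*} [NormedAddCommGroup E₁] [NormedSpace ℝ E₁] [NormedAddCommGroup E₂] [NormedSpace ℝ E₂]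
  [NormedAddCommGroup G] [NormedSpace ℝ G]

/-- **Two-scale Leibniz for a continuous bilinear map**: if `f`, `g` are `Cⁿ` on an open `s ∋ x` with
`‖f^{(i)}(x)‖ ≤ A σ^{min(i,2)} ρⁱ`, `‖g^{(i)}(x)‖ ≤ A' σ^{min(i,2)} ρⁱ` for `i ≤ n` (`0 ≤ σ ≤ 1`, `ρ ≥ 0`), then
`‖(B(f,g))^{(k)}(x)‖ ≤ ‖B‖ 2ⁿ A A' σ^{min(k,2)} ρᵏ` for `k ≤ n`. [cite: BenfattoGiulianiMastropietro2006, §2.5 proof of Lemma 2.2 (2.55) p0011:L17–L22] -/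
theorem norm_iteratedDeriv_bilinear_le_twoScale (B : E₁ →L[ℝ] E₂ →L[ℝ] G) {f : ℝ → E₁} {g : ℝ → E₂} {n : ℕ}
    {s : Set ℝ} (hs : IsOpen s) {x : ℝ} (hx : x ∈ s) (hf : ContDiffOn ℝ n f s) (hg : ContDiffOn ℝ n g s)
    {A A' σ ρ : ℝ} (hσ0 : 0 ≤ σ) (hσ1 : σ ≤ 1) (hρ : 0 ≤ ρ)
    (hA : ∀ i ≤ n, ‖iteratedDeriv i f x‖ ≤ A * σ ^ min i 2 * ρ ^ i)
    (hA' : ∀ i ≤ n, ‖iteratedDeriv i g x‖ ≤ A' * σ ^ min i 2 * ρ ^ i) {k : ℕ} (hk : k ≤ n) :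
    ‖iteratedDeriv k (fun y => B (f y) (g y)) x‖ ≤ ‖B‖ * 2 ^ n * A * A' * σ ^ min k 2 * ρ ^ k := by
  have hA0 := nonneg_of_profile hA
  have hA0' := nonneg_of_profile hA'
  have hL := B.norm_iteratedFDerivWithin_le_of_bilinear (hf.of_le (by exact_mod_cast hk))
    (hg.of_le (by exact_mod_cast hk)) hs.uniqueDiffOn hx (n := k) le_rfl
  simp only [norm_iteratedFDerivWithin_eq_of_isOpen hs hx] at hL
  refine hL.trans ?_
  have hsum := sum_choose_mul_le_twoScale (n := k) (a := fun i => ‖iteratedDeriv i f x‖)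
    (b := fun i => ‖iteratedDeriv i g x‖) hσ0 hσ1 hρ (fun i _ => norm_nonneg _)
    (fun i hi => hA i (hi.trans hk)) (fun i hi => hA' i (hi.trans hk)) hA0 hA0'
  have h2 : (2 : ℝ) ^ k ≤ 2 ^ n := pow_le_pow_right₀ (by norm_num) hk
  calc ‖B‖ * ∑ i ∈ range (k + 1), (k.choose i : ℝ) * ‖iteratedDeriv i f x‖ * ‖iteratedDeriv (k - i) g x‖
      ≤ ‖B‖ * (2 ^ k * A * A' * σ ^ min k 2 * ρ ^ k) := mul_le_mul_of_nonneg_left hsum (ContinuousLinearMap.opNorm_nonneg B)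
    _ ≤ ‖B‖ * (2 ^ n * A * A' * σ ^ min k 2 * ρ ^ k) := by
        refine mul_le_mul_of_nonneg_left ?_ (ContinuousLinearMap.opNorm_nonneg B)
        have : 0 ≤ A * A' * σ ^ min k 2 * ρ ^ k := by positivity
        calc 2 ^ k * A * A' * σ ^ min k 2 * ρ ^ k = 2 ^ k * (A * A' * σ ^ min k 2 * ρ ^ k) := by ring
          _ ≤ 2 ^ n * (A * A' * σ ^ min k 2 * ρ ^ k) := mul_le_mul_of_nonneg_right h2 this
          _ = _ := by ring
    _ = _ := by ring

end Bilinear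

/-! ### Products -/

section Products

variable {𝔸 : Type*} [NormedRing 𝔸] [NormedAlgebra ℝ 𝔸]

/-- **Two-scale Leibniz**: if `f`, `g` are `Cⁿ` on an open `s ∋ x` with `‖f^{(i)}(x)‖ ≤ A σ^{min(i,2)} ρⁱ` and
`‖g^{(i)}(x)‖ ≤ B σ^{min(i,2)} ρⁱ` for all `i ≤ n` (`0 ≤ σ ≤ 1`, `ρ ≥ 0`), then
`‖(fg)^{(k)}(x)‖ ≤ 2ⁿ A B σ^{min(k,2)} ρᵏ` for `k ≤ n` (the products of the factors `F_{h,ω}`, `1/D_{h-1}` of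
(2.55) keep the tangential gain). [cite: BenfattoGiulianiMastropietro2006, §2.5 proof of Lemma 2.2 (2.55) p0011:L17–L22] -/
theorem norm_iteratedDeriv_mul_le_twoScale {f g : ℝ → 𝔸} {n : ℕ} {s : Set ℝ} (hs : IsOpen s) {x : ℝ} (hx : x ∈ s)
    (hf : ContDiffOn ℝ n f s) (hg : ContDiffOn ℝ n g s) {A B σ ρ : ℝ} (hσ0 : 0 ≤ σ) (hσ1 : σ ≤ 1) (hρ : 0 ≤ ρ)
    (hA : ∀ i ≤ n, ‖iteratedDeriv i f x‖ ≤ A * σ ^ min i 2 * ρ ^ i)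
    (hB : ∀ i ≤ n, ‖iteratedDeriv i g x‖ ≤ B * σ ^ min i 2 * ρ ^ i) {k : ℕ} (hk : k ≤ n) :
    ‖iteratedDeriv k (fun y => f y * g y) x‖ ≤ 2 ^ n * A * B * σ ^ min k 2 * ρ ^ k := by
  have hA0 := nonneg_of_profile hA
  have hB0 := nonneg_of_profile hB
  have hL := norm_iteratedFDerivWithin_mul_le (hf.of_le (by exact_mod_cast hk)) (hg.of_le (by exact_mod_cast hk))
    hs.uniqueDiffOn hx (n := k) le_rfl
  simp only [norm_iteratedFDerivWithin_eq_of_isOpen hs hx] at hL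
  refine hL.trans ?_
  have hsum := sum_choose_mul_le_twoScale (n := k) (a := fun i => ‖iteratedDeriv i f x‖)
    (b := fun i => ‖iteratedDeriv i g x‖) hσ0 hσ1 hρ (fun i _ => norm_nonneg _)
    (fun i hi => hA i (hi.trans hk)) (fun i hi => hB i (hi.trans hk)) hA0 hB0
  refine hsum.trans ?_
  have h2 : (2 : ℝ) ^ k ≤ 2 ^ n := pow_le_pow_right₀ (by norm_num) hk
  have : 0 ≤ A * B * σ ^ min k 2 * ρ ^ k := by positivity
  calc 2 ^ k * A * B * σ ^ min k 2 * ρ ^ k = 2 ^ k * (A * B * σ ^ min k 2 * ρ ^ k) := by ring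
    _ ≤ 2 ^ n * (A * B * σ ^ min k 2 * ρ ^ k) := mul_le_mul_of_nonneg_right h2 this
    _ = _ := by ring

end Products

/-! ### Scalar multiples -/

section Smul

variable {F : Type*} [NormedAddCommGroup F] [NormedSpace ℝ F]

/-- **Two-scale Leibniz for `f • g`** (`f` real, `g` vector-valued, both `Cⁿ` on an open `s ∋ x`): same
constants `2ⁿAB`. [cite: BenfattoGiulianiMastropietro2006, §2.5 proof of Lemma 2.2 (2.55) p0011:L17–L22] -/
theorem norm_iteratedDeriv_smul_le_twoScale {f : ℝ → ℝ} {g : ℝ → F} {n : ℕ} {s : Set ℝ} (hs : IsOpen s) {x : ℝ}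
    (hx : x ∈ s) (hf : ContDiffOn ℝ n f s) (hg : ContDiffOn ℝ n g s) {A B σ ρ : ℝ} (hσ0 : 0 ≤ σ) (hσ1 : σ ≤ 1)
    (hρ : 0 ≤ ρ) (hA : ∀ i ≤ n, ‖iteratedDeriv i f x‖ ≤ A * σ ^ min i 2 * ρ ^ i)
    (hB : ∀ i ≤ n, ‖iteratedDeriv i g x‖ ≤ B * σ ^ min i 2 * ρ ^ i) {k : ℕ} (hk : k ≤ n) :
    ‖iteratedDeriv k (fun y => f y • g y) x‖ ≤ 2 ^ n * A * B * σ ^ min k 2 * ρ ^ k := by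
  have hA0 := nonneg_of_profile hA
  have hB0 := nonneg_of_profile hB
  have hL := norm_iteratedFDerivWithin_smul_le (𝕜 := ℝ) (hf.of_le (by exact_mod_cast hk))
    (hg.of_le (by exact_mod_cast hk)) hs.uniqueDiffOn hx (n := k) le_rfl
  simp only [norm_iteratedFDerivWithin_eq_of_isOpen hs hx] at hL
  refine hL.trans ?_
  have hsum := sum_choose_mul_le_twoScale (n := k) (a := fun i => ‖iteratedDeriv i f x‖)
    (b := fun i => ‖iteratedDeriv i g x‖) hσ0 hσ1 hρ (fun i _ => norm_nonneg _)
    (fun i hi => hA i (hi.trans hk)) (fun i hi => hB i (hi.trans hk)) hA0 hB0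
  refine hsum.trans ?_
  have h2 : (2 : ℝ) ^ k ≤ 2 ^ n := pow_le_pow_right₀ (by norm_num) hk
  have : 0 ≤ A * B * σ ^ min k 2 * ρ ^ k := by positivity
  calc 2 ^ k * A * B * σ ^ min k 2 * ρ ^ k = 2 ^ k * (A * B * σ ^ min k 2 * ρ ^ k) := by ring
    _ ≤ 2 ^ n * (A * B * σ ^ min k 2 * ρ ^ k) := mul_le_mul_of_nonneg_right h2 this
    _ = _ := by ring

end Smul

/-! ### Composition with a function of bounded derivatives -/

section Comp

variable {F : Type*} [NormedAddCommGroup F] [NormedSpace ℝ F]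

/-- **Two-scale Faà di Bruno**: let `f : ℝ → ℝ` be `Cⁿ` on an open `s ∋ x`, mapping `s` into an open `t`,
with `‖f^{(i)}(x)‖ ≤ A σ^{min(i,2)} ρⁱ` for `1 ≤ i ≤ n` (`0 ≤ σ ≤ 1`, `ρ ≥ 0`, `A ≥ 0`), and let
`g : ℝ → F` be `Cⁿ` on `t` with `‖g^{(m)}(f(x))‖ ≤ G` for `m ≤ n`.  Then for `k ≤ n`,
`‖(g ∘ f)^{(k)}(x)‖ ≤ G (2ⁿ(1 + A))ᵏ σ^{min(k,2)} ρᵏ`: the chain rule `(g ∘ f)' = f'·(g' ∘ f)` near `x` and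
the two-scale Leibniz bound, by strong induction on the order (the cutoffs `H₀(γ^{-h}|D_h|)`, the sector
weight and the inverse denominator of (2.55) are such compositions). [cite: BenfattoGiulianiMastropietro2006, §2.5 proof of Lemma 2.2 (2.55) p0011:L17–L22] -/
theorem norm_iteratedDeriv_comp_le_twoScale {n : ℕ} {f : ℝ → ℝ} {s t : Set ℝ} (hs : IsOpen s) (ht : IsOpen t)
    {x : ℝ} (hx : x ∈ s) (hf : ContDiffOn ℝ n f s) (hst : MapsTo f s t)
    {A G σ ρ : ℝ} (hσ0 : 0 ≤ σ) (hσ1 : σ ≤ 1) (hρ : 0 ≤ ρ) (hA0 : 0 ≤ A)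
    (hA : ∀ i, 1 ≤ i → i ≤ n → ‖iteratedDeriv i f x‖ ≤ A * σ ^ min i 2 * ρ ^ i)
    {g : ℝ → F} (hg : ContDiffOn ℝ n g t) (hG : ∀ m ≤ n, ‖iteratedDeriv m g (f x)‖ ≤ G) {k : ℕ} (hk : k ≤ n) :
    ‖iteratedDeriv k (fun y => g (f y)) x‖ ≤ G * (2 ^ n * (1 + A)) ^ k * σ ^ min k 2 * ρ ^ k := by
  set M : ℝ := 2 ^ n * (1 + A) with hM
  have hM1 : 1 ≤ M := by
    rw [hM]; nlinarith [one_le_pow₀ (by norm_num : (1 : ℝ) ≤ 2) (n := n)]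
  have hG0 : 0 ≤ G := (norm_nonneg _).trans (hG 0 (Nat.zero_le n))
  -- strong induction on the order, over all outer functions `Cʲ` on `t` with bounded derivatives at `f x`
  have key : ∀ k : ℕ, ∀ j ≤ k, j ≤ n → ∀ (g : ℝ → F), ContDiffOn ℝ j g t →
      (∀ m ≤ j, ‖iteratedDeriv m g (f x)‖ ≤ G) →
      ‖iteratedDeriv j (fun y => g (f y)) x‖ ≤ G * M ^ j * σ ^ min j 2 * ρ ^ j := by
    intro k
    induction k with
    | zero =>
      intro j hj hjn g hg hGg
      have hj0 : j = 0 := Nat.le_zero.1 hj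
      subst hj0
      simp only [iteratedDeriv_zero, pow_zero, mul_one, Nat.zero_min]
      exact hGg 0 le_rfl
    | succ k ih =>
      intro j hj hjn g hg hGg
      rcases Nat.lt_or_ge j (k + 1) with hlt | hge
      · exact ih j (Nat.lt_succ_iff.1 hlt) hjn g hg hGg
      · have hjk : j = k + 1 := le_antisymm hj hge
        subst hjk
        -- `(g ∘ f)' = f' • (g' ∘ f)` near `x`
        have hfk : ContDiffOn ℝ ((k : ℕ∞) + 1) f s := hf.of_le (by exact_mod_cast hjn)
        have hfd : ∀ y ∈ s, DifferentiableAt ℝ f y := fun y hy =>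
          (hfk.differentiableOn (by simp)).differentiableAt (hs.mem_nhds hy)
        have hgd : ∀ z ∈ t, DifferentiableAt ℝ g z := fun z hz =>
          (hg.differentiableOn (by simp)).differentiableAt (ht.mem_nhds hz)
        have hchain : deriv (fun y => g (f y)) =ᶠ[nhds x] fun y => deriv f y • deriv g (f y) := by
          filter_upwards [hs.mem_nhds hx] with y hy
          exact deriv.scomp y (hgd _ (hst hy)) (hfd y hy)
        have hf' : ContDiffOn ℝ k (deriv f) s := ((contDiffOn_succ_iff_deriv_of_isOpen hs).1 hfk).2.2
        have hg' : ContDiffOn ℝ k (deriv g) t := ((contDiffOn_succ_iff_deriv_of_isOpen ht).1 hg).2.2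
        have hg'f : ContDiffOn ℝ k (fun y => deriv g (f y)) s :=
          hg'.comp (hf.of_le (by exact_mod_cast (by omega : k ≤ n))) hst
        rw [iteratedDeriv_succ', Filter.EventuallyEq.iteratedDeriv_eq k hchain]
        -- Leibniz on `s`
        have hL := norm_iteratedFDerivWithin_smul_le (𝕜 := ℝ) hf' hg'f hs.uniqueDiffOn hx (n := k) le_rfl
        simp only [norm_iteratedFDerivWithin_eq_of_isOpen hs hx] at hL
        refine hL.trans ?_
        -- the factors: `f'` has the shifted profile, `g' ∘ f` the inductive one
        have hA' : ∀ i ≤ k, ‖iteratedDeriv i (deriv f) x‖ ≤ A * σ ^ min (i + 1) 2 * ρ ^ (i + 1) := by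
          intro i hi
          rw [← iteratedDeriv_succ']
          exact hA (i + 1) (by omega) (by omega)
        have hB' : ∀ i ≤ k, ‖iteratedDeriv i (fun y => deriv g (f y)) x‖ ≤ G * M ^ i * σ ^ min i 2 * ρ ^ i := by
          intro i hi
          refine ih i hi (by omega) (deriv g) (hg'.of_le (by exact_mod_cast hi)) fun m hm => ?_
          rw [← iteratedDeriv_succ']
          exact hGg (m + 1) (by omega)
        calc ∑ i ∈ range (k + 1), (k.choose i : ℝ) * ‖iteratedDeriv i (deriv f) x‖ *
              ‖iteratedDeriv (k - i) (fun y => deriv g (f y)) x‖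
            ≤ ∑ i ∈ range (k + 1), (k.choose i : ℝ) * (A * G * M ^ k * σ ^ min (k + 1) 2 * ρ ^ (k + 1)) := by
              refine sum_le_sum fun i hi => ?_
              have hik : i ≤ k := Nat.lt_succ_iff.1 (mem_range.1 hi)
              rw [mul_assoc]
              refine mul_le_mul_of_nonneg_left ?_ (Nat.cast_nonneg _)
              calc ‖iteratedDeriv i (deriv f) x‖ * ‖iteratedDeriv (k - i) (fun y => deriv g (f y)) x‖
                  ≤ (A * σ ^ min (i + 1) 2 * ρ ^ (i + 1)) * (G * M ^ (k - i) * σ ^ min (k - i) 2 * ρ ^ (k - i)) :=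
                    mul_le_mul (hA' i hik) (hB' (k - i) (Nat.sub_le k i)) (norm_nonneg _) (by positivity)
                _ = A * G * M ^ (k - i) * (σ ^ min (i + 1) 2 * σ ^ min (k - i) 2) * (ρ ^ (i + 1) * ρ ^ (k - i)) := by
                    ring
                _ ≤ A * G * M ^ k * σ ^ min (k + 1) 2 * (ρ ^ (i + 1) * ρ ^ (k - i)) := by
                    have h1 := pow_min_two_mul_le hσ0 hσ1 (i + 1) (k - i)
                    rw [show i + 1 + (k - i) = k + 1 by omega] at h1
                    have h2 : M ^ (k - i) ≤ M ^ k := pow_le_pow_right₀ hM1 (Nat.sub_le k i)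
                    have h3 : 0 ≤ ρ ^ (i + 1) * ρ ^ (k - i) := by positivity
                    have h4 : 0 ≤ σ ^ min (i + 1) 2 * σ ^ min (k - i) 2 := by positivity
                    have h5 : A * G * M ^ (k - i) * (σ ^ min (i + 1) 2 * σ ^ min (k - i) 2) ≤
                        A * G * M ^ k * σ ^ min (k + 1) 2 :=
                      mul_le_mul (mul_le_mul_of_nonneg_left h2 (mul_nonneg hA0 hG0)) h1 h4 (by positivity)
                    exact mul_le_mul_of_nonneg_right h5 h3
                _ = A * G * M ^ k * σ ^ min (k + 1) 2 * ρ ^ (k + 1) := by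
                    rw [← pow_add, show i + 1 + (k - i) = k + 1 by omega]
          _ = 2 ^ k * A * (G * M ^ k * σ ^ min (k + 1) 2 * ρ ^ (k + 1)) := by
              rw [← sum_mul]
              have h : ∑ i ∈ range (k + 1), (k.choose i : ℝ) = 2 ^ k := by exact_mod_cast Nat.sum_range_choose k
              rw [h]; ring
          _ ≤ M * (G * M ^ k * σ ^ min (k + 1) 2 * ρ ^ (k + 1)) := by
              refine mul_le_mul_of_nonneg_right ?_ (by positivity)
              rw [hM]
              have h2k : (2 : ℝ) ^ k ≤ 2 ^ n := pow_le_pow_right₀ (by norm_num) (by omega)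
              nlinarith [pow_nonneg (by norm_num : (0 : ℝ) ≤ 2) k]
          _ = G * M ^ (k + 1) * σ ^ min (k + 1) 2 * ρ ^ (k + 1) := by ring
  exact key k k le_rfl hk g (hg.of_le (by exact_mod_cast hk)) fun m hm => hG m (hm.trans hk)

/-- **Two-scale Faà di Bruno, profile form**: under the hypotheses of `norm_iteratedDeriv_comp_le_twoScale`,
`g ∘ f` has the two-scale profile with constant `G(2ⁿ(1 + A))ⁿ` at all orders `k ≤ n`.
[cite: BenfattoGiulianiMastropietro2006, §2.5 proof of Lemma 2.2 (2.55) p0011:L17–L22] -/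
theorem norm_iteratedDeriv_comp_le_twoScale' {n : ℕ} {f : ℝ → ℝ} {s t : Set ℝ} (hs : IsOpen s) (ht : IsOpen t)
    {x : ℝ} (hx : x ∈ s) (hf : ContDiffOn ℝ n f s) (hst : MapsTo f s t)
    {A G σ ρ : ℝ} (hσ0 : 0 ≤ σ) (hσ1 : σ ≤ 1) (hρ : 0 ≤ ρ) (hA0 : 0 ≤ A)
    (hA : ∀ i, 1 ≤ i → i ≤ n → ‖iteratedDeriv i f x‖ ≤ A * σ ^ min i 2 * ρ ^ i)
    {g : ℝ → F} (hg : ContDiffOn ℝ n g t) (hG : ∀ m ≤ n, ‖iteratedDeriv m g (f x)‖ ≤ G) :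
    ∀ k ≤ n, ‖iteratedDeriv k (fun y => g (f y)) x‖ ≤ G * (2 ^ n * (1 + A)) ^ n * σ ^ min k 2 * ρ ^ k := by
  intro k hk
  refine (norm_iteratedDeriv_comp_le_twoScale hs ht hx hf hst hσ0 hσ1 hρ hA0 hA hg hG hk).trans ?_
  have hG0 : 0 ≤ G := (norm_nonneg _).trans (hG 0 (Nat.zero_le n))
  have hM1 : (1 : ℝ) ≤ 2 ^ n * (1 + A) := by nlinarith [one_le_pow₀ (by norm_num : (1 : ℝ) ≤ 2) (n := n)]
  have h := pow_le_pow_right₀ hM1 hk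
  have : 0 ≤ σ ^ min k 2 * ρ ^ k := by positivity
  calc G * (2 ^ n * (1 + A)) ^ k * σ ^ min k 2 * ρ ^ k = G * (2 ^ n * (1 + A)) ^ k * (σ ^ min k 2 * ρ ^ k) := by ring
    _ ≤ G * (2 ^ n * (1 + A)) ^ n * (σ ^ min k 2 * ρ ^ k) :=
        mul_le_mul_of_nonneg_right (mul_le_mul_of_nonneg_left h hG0) this
    _ = _ := by ring

end Comp

end Literature.MathematicalPhysics.QuantumLattice.FermiRG
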